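import Literature.Analysis.FluidPDE.FourierL2PicardClass
import Literature.Analysis.FluidPDE.FourierL2DuhamelIntegrated
import HarnessLib

/-!
# The Picard iteration in the weighted-`L²` class: transfer of the `Φ²`-bounds to the next iterate

Ninth file of the weighted-`L²` Fourier-side construction of the local smooth solution of the
Navier–Stokes system with `H¹`-controlled lifespan (discharge of
`Literature.Analysis.FluidPDE.tao2011_fourier_local_existence`; Tao 2013, Thm. 5.4 (ii)+(iv)).
For a trajectory `v = h - E` of the class of `FourierL2PicardClass` (`h(t) = heat(clamp t) • a`,
`E` jointly continuous with decay) put `E' = duhamelIntegral c T v` and `v' = h - E'` (the next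
Picard iterate) and let

  `Φ²(ξ) = ∫⁻_{(0,T]} (C_N ‖(M_v(s) ⋆ M_v(s))(ξ)‖ₑ)² ds`,  `C_N = 4π · 9`,

be the controlling function of `FourierL2DuhamelStep`. This file converts bounds on the weighted
integrals `I_k = ∫ ‖ξ‖^{2k} Φ²(ξ) dξ` into the `X¹/X²`-type quantities of `v'`, with the datum
entering through `α_k = ∫⁻ (‖η‖^k ∑ⱼ‖a η j‖ₑ)²`:

* `sup_weight_majorant_next_sq_le` (sup in time, weight `‖η‖^k`):
  `∫⁻ (ρ^k M_{v'}(t))² ≤ 2α_k + 18 (2c)⁻¹ I_k` for `t ∈ [0, T]` (envelope bound of the step);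
* `lintegral_time_weight_majorant_next_sq_le` (`L²` in time, weight `‖η‖^{k+1}`, `k ≥ 1`):
  `∫⁻_{(0,T]} ∫⁻ (ρ^{k+1} M_{v'}(s))² ≤ c⁻¹ α_k + 18 c⁻² I_k` — the heat part gains one power of
  `‖η‖` from `2c‖η‖² ∫₀ᵀ heat² ≤ 1` (tree `two_mul_norm_sq_mul_integral_heat_sq_le`), the Duhamel
  part from the Schur bound of the step;
* `sup_majorant_next_sq_le` (plain `L²` level): `∫⁻ (M_{v'}(t))² ≤ 2α₀ + 18 T I₁`
  (low-frequency envelope bound).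

Together with `FourierL2DuhamelIntegrated` (which bounds `I₁`, `I₂` by the same quantities of
`v`) these close the recursion of Tao's `X¹` contraction (proof of Thm. 5.1/5.4, arXiv p. 16) in
the next file.

## Wide class (forced twin)

Every theorem of this file taking `hEc : Continuous (uncurry E)` has a primed twin taking instead
`(hEm : Measurable (uncurry E)) (hEt : ∀ η, Continuous fun s => E s η)` — joint measurability and
continuity in time at each frequency, which is all the proofs use of the joint continuity (slice
and joint measurability, dominated convergence in time). This is the class of `E = D - F`, `D`
jointly continuous, `F = ∫₀ᵗ heat(t-s) • b(s) ds` a forcing term whose Leray-projected coefficient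
`b` is discontinuous at `ξ = 0` (forced twin `ForcedFourier*`; Tao 2013, Thm. 5.4 is stated and
proved WITH the force). The unprimed theorems are their specialisations.

## References

* T. Tao, Anal. PDE 6 (2013) = arXiv:1108.1165, Lemma 2.1 = arXiv Lemma 23 and the proof of
  Thm. 5.1/5.4 (arXiv pp. 16, 18). [Tao2011]
-/

noncomputable section

open MeasureTheory Real Set Filter Function intervalIntegral
open scoped ENNReal NNReal
open _root_.Topology

namespace Literature.Analysis.FluidPDE.FourierNS

variable {c T : ℝ} {a : EuclideanSpace ℝ (Fin 3) → Fin 3 → ℂ}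
  {E : ℝ → EuclideanSpace ℝ (Fin 3) → Fin 3 → ℂ}

/-! ### The trajectory hypotheses of the step, for `v = h - E` -/

/-- The square of the majorant is at most `9` times the square of the extended norm
(`∑ⱼ ‖xⱼ‖ₑ ≤ 3 ‖x‖ₑ` for `x : Fin 3 → ℂ`). [folklore] -/
theorem majorant_sq_le_nine_mul_enorm_sq (x : Fin 3 → ℂ) : (∑ j, ‖x j‖ₑ) ^ 2 ≤ 9 * ‖x‖ₑ ^ 2 := by
  have h1 : ∀ j, ‖x j‖ₑ ≤ ‖x‖ₑ := fun j => by
    rw [← ofReal_norm, ← ofReal_norm]; exact ENNReal.ofReal_le_ofReal (norm_le_pi_norm x j)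
  calc (∑ j, ‖x j‖ₑ) ^ 2 ≤ (∑ _j : Fin 3, ‖x‖ₑ) ^ 2 := by gcongr with j _; exact h1 j
    _ = 9 * ‖x‖ₑ ^ 2 := by simp [Finset.sum_const, Finset.card_univ]; ring

/-! ### Sup-in-time transfer (envelope bound of the step) -/

/-- **Sup transfer, weight `‖η‖^k`.** Let `v = h - E` with `E` of the class, `c > 0`, `T ≥ 0`, and
let `I` dominate `∫ ‖ξ‖^{2k} Φ²`. Then for every `t ∈ [0, T]` the next iterate
`v' = h - duhamelIntegral c T v` satisfies
`∫⁻ (‖η‖^k ∑ⱼ‖v'(t)ⱼ‖ₑ)² ≤ 2 α_k + 18 · (2c)⁻¹ · I`,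
`α_k = ∫⁻ (‖η‖^k ∑ⱼ‖aⱼ‖ₑ)²` (`|heat| ≤ 1`, `(∑ⱼ‖·‖ₑ)² ≤ 9‖·‖ₑ²` and the envelope bound
`‖E'(t,η)‖ₑ² ≤ (2c)⁻¹ ∫⁻ φ_η²` of `enorm_bilinDuhamel_sq_le`). [cite: Tao2011, Lemma 2.1 (arXiv Lemma 23)]
Twin for the wide (jointly measurable, time-continuous at each frequency) class of `E`. -/
theorem sup_weight_majorant_next_sq_le' (hc : 0 < c)
    (ha : AEStronglyMeasurable a volume)
    (haw : ∀ (k : ℕ) j, ∫⁻ η, (ENNReal.ofReal ((1 + ‖η‖) ^ k) * ‖a η j‖ₑ) ^ 2 < ⊤)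
    (hEm : Measurable (uncurry E)) (hEt : ∀ η, Continuous fun s => E s η)
    (hEd : ∀ K : ℕ, ∃ B : ℝ, ∀ t, HasDecay K B (E t))
    (k : ℕ) {I : ℝ≥0∞}
    (hI : ∫⁻ ξ, ENNReal.ofReal (‖ξ‖ ^ (2 * k)) * ∫⁻ s in Ioc 0 T, (ENNReal.ofReal (4 * π) *
        (Fintype.card (Fin 3) : ℝ≥0∞) ^ 2 *
        ‖fconv (fun η => ((∑ j, ‖(heat c η (clamp T s) • a η - E s η) j‖ : ℝ) : ℂ))
          (fun η => ((∑ j, ‖(heat c η (clamp T s) • a η - E s η) j‖ : ℝ) : ℂ)) ξ‖ₑ) ^ 2 ≤ I)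
    {t : ℝ} (ht : t ∈ Icc 0 T) :
    ∫⁻ η, (ENNReal.ofReal (‖η‖ ^ k) * ∑ j, ‖(heat c η (clamp T t) • a η -
        duhamelIntegral c T (fun s ζ => heat c ζ (clamp T s) • a ζ - E s ζ) t η) j‖ₑ) ^ 2 ≤
      2 * (∫⁻ η, (ENNReal.ofReal (‖η‖ ^ k) * ∑ j, ‖a η j‖ₑ) ^ 2) +
        18 * ENNReal.ofReal (1 / (2 * c)) * I := by
  set v : ℝ → EuclideanSpace ℝ (Fin 3) → Fin 3 → ℂ := fun s η => heat c η (clamp T s) • a η - E s η with hv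
  set E' := duhamelIntegral c T v with hE'
  -- the trajectory package of `v`
  set m₀ := Module.finrank ℝ (EuclideanSpace ℝ (Fin 3)) + 1 with hm₀
  have hm₀lt : Module.finrank ℝ (EuclideanSpace ℝ (Fin 3)) < 2 * m₀ := finrank_lt_two_mul_succ
  have ha2 : ∀ j, ∫⁻ η, ‖a η j‖ₑ ^ 2 < ⊤ := fun j => by simpa using haw 0 j
  obtain ⟨B₀, hB₀⟩ := hEd m₀
  have hvm : ∀ s, AEStronglyMeasurable (v s) volume := aestronglyMeasurable_hsub_slice' c T a E ha hEm
  have hv2 : ∀ s j, MemLp (v s · j) 2 volume := memLp_hsub_apply' c T a E hc.le ha ha2 hEm hm₀lt hB₀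
  have hvc : ∀ j s₀, Tendsto (fun s => eLpNorm ((v s · j) - (v s₀ · j)) 2 volume) (𝓝 s₀) (𝓝 0) :=
    tendsto_eLpNorm_hsub_apply' c T a E hc.le ha ha2 hEm hEt hm₀lt hB₀
  -- the pointwise envelope bound of `E' t`
  set Φsq : EuclideanSpace ℝ (Fin 3) → ℝ≥0∞ := fun ξ => ∫⁻ s in Ioc 0 T, (ENNReal.ofReal (4 * π) *
    (Fintype.card (Fin 3) : ℝ≥0∞) ^ 2 * ‖fconv (fun η => ((∑ j, ‖v s η j‖ : ℝ) : ℂ))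
      (fun η => ((∑ j, ‖v s η j‖ : ℝ) : ℂ)) ξ‖ₑ) ^ 2 with hΦsq
  have henv : ∀ η, ‖E' t η‖ₑ ^ 2 ≤ ENNReal.ofReal (1 / (2 * c)) * Φsq η := by
    intro η
    have h := enorm_bilinDuhamel_sq_le (T := T) hc hvm hvm hv2 hv2 hvc hvc ht η
    rw [hE', duhamelIntegral, clamp_of_mem ht]
    exact h
  -- the weight does not exceed the homogeneous one: we use the general weighted split
  have hW : Measurable fun η : EuclideanSpace ℝ (Fin 3) => ENNReal.ofReal (‖η‖ ^ k) :=
    (ENNReal.continuous_ofReal.comp (continuous_norm.pow k)).measurable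
  have hsplit := lintegral_weight_majorant_sub_sq_le (T := T) (a := a) (E := E') hc.le ha hW t
  have hE'maj : ∫⁻ η, (ENNReal.ofReal (‖η‖ ^ k) * ∑ j, ‖E' t η j‖ₑ) ^ 2 ≤
      9 * ENNReal.ofReal (1 / (2 * c)) * I := by
    calc ∫⁻ η, (ENNReal.ofReal (‖η‖ ^ k) * ∑ j, ‖E' t η j‖ₑ) ^ 2
        ≤ ∫⁻ η, 9 * ENNReal.ofReal (1 / (2 * c)) * (ENNReal.ofReal (‖η‖ ^ (2 * k)) * Φsq η) := by
          refine lintegral_mono fun η => ?_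
          rw [mul_pow]
          calc ENNReal.ofReal (‖η‖ ^ k) ^ 2 * (∑ j, ‖E' t η j‖ₑ) ^ 2
              ≤ ENNReal.ofReal (‖η‖ ^ k) ^ 2 * (9 * ‖E' t η‖ₑ ^ 2) := by
                gcongr; exact majorant_sq_le_nine_mul_enorm_sq _
            _ ≤ ENNReal.ofReal (‖η‖ ^ k) ^ 2 * (9 * (ENNReal.ofReal (1 / (2 * c)) * Φsq η)) := by
                gcongr; exact henv η
            _ = 9 * ENNReal.ofReal (1 / (2 * c)) * (ENNReal.ofReal (‖η‖ ^ (2 * k)) * Φsq η) := by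
                rw [← ENNReal.ofReal_pow (by positivity), ← pow_mul, mul_comm k 2]; ring
      _ = 9 * ENNReal.ofReal (1 / (2 * c)) * ∫⁻ η, ENNReal.ofReal (‖η‖ ^ (2 * k)) * Φsq η :=
          lintegral_const_mul' _ _ (ENNReal.mul_ne_top (by norm_num) ENNReal.ofReal_ne_top)
      _ ≤ 9 * ENNReal.ofReal (1 / (2 * c)) * I := mul_le_mul' le_rfl hI
  calc ∫⁻ η, (ENNReal.ofReal (‖η‖ ^ k) * ∑ j, ‖(heat c η (clamp T t) • a η - E' t η) j‖ₑ) ^ 2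
      ≤ 2 * (∫⁻ η, (ENNReal.ofReal (‖η‖ ^ k) * ∑ j, ‖a η j‖ₑ) ^ 2) +
          2 * (∫⁻ η, (ENNReal.ofReal (‖η‖ ^ k) * ∑ j, ‖E' t η j‖ₑ) ^ 2) := hsplit
    _ ≤ 2 * (∫⁻ η, (ENNReal.ofReal (‖η‖ ^ k) * ∑ j, ‖a η j‖ₑ) ^ 2) +
          2 * (9 * ENNReal.ofReal (1 / (2 * c)) * I) := by gcongr
    _ = _ := by ring

/-- **Sup transfer, weight `‖η‖^k`.** Let `v = h - E` with `E` of the class, `c > 0`, `T ≥ 0`, and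
let `I` dominate `∫ ‖ξ‖^{2k} Φ²`. Then for every `t ∈ [0, T]` the next iterate
`v' = h - duhamelIntegral c T v` satisfies
`∫⁻ (‖η‖^k ∑ⱼ‖v'(t)ⱼ‖ₑ)² ≤ 2 α_k + 18 · (2c)⁻¹ · I`,
`α_k = ∫⁻ (‖η‖^k ∑ⱼ‖aⱼ‖ₑ)²` (`|heat| ≤ 1`, `(∑ⱼ‖·‖ₑ)² ≤ 9‖·‖ₑ²` and the envelope bound
`‖E'(t,η)‖ₑ² ≤ (2c)⁻¹ ∫⁻ φ_η²` of `enorm_bilinDuhamel_sq_le`). [cite: Tao2011, Lemma 2.1 (arXiv Lemma 23)] -/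
theorem sup_weight_majorant_next_sq_le (hc : 0 < c)
    (ha : AEStronglyMeasurable a volume)
    (haw : ∀ (k : ℕ) j, ∫⁻ η, (ENNReal.ofReal ((1 + ‖η‖) ^ k) * ‖a η j‖ₑ) ^ 2 < ⊤)
    (hEc : Continuous (uncurry E)) (hEd : ∀ K : ℕ, ∃ B : ℝ, ∀ t, HasDecay K B (E t))
    (k : ℕ) {I : ℝ≥0∞}
    (hI : ∫⁻ ξ, ENNReal.ofReal (‖ξ‖ ^ (2 * k)) * ∫⁻ s in Ioc 0 T, (ENNReal.ofReal (4 * π) *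
        (Fintype.card (Fin 3) : ℝ≥0∞) ^ 2 *
        ‖fconv (fun η => ((∑ j, ‖(heat c η (clamp T s) • a η - E s η) j‖ : ℝ) : ℂ))
          (fun η => ((∑ j, ‖(heat c η (clamp T s) • a η - E s η) j‖ : ℝ) : ℂ)) ξ‖ₑ) ^ 2 ≤ I)
    {t : ℝ} (ht : t ∈ Icc 0 T) :
    ∫⁻ η, (ENNReal.ofReal (‖η‖ ^ k) * ∑ j, ‖(heat c η (clamp T t) • a η -
        duhamelIntegral c T (fun s ζ => heat c ζ (clamp T s) • a ζ - E s ζ) t η) j‖ₑ) ^ 2 ≤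
      2 * (∫⁻ η, (ENNReal.ofReal (‖η‖ ^ k) * ∑ j, ‖a η j‖ₑ) ^ 2) +
        18 * ENNReal.ofReal (1 / (2 * c)) * I :=
  sup_weight_majorant_next_sq_le' hc ha haw hEc.measurable (fun η => hEc.uncurry_right η) hEd k hI ht

/-! ### Plain `L²` transfer (low-frequency envelope bound) -/

/-- **Plain `L²` transfer.** With the notation of `sup_weight_majorant_next_sq_le` and `I`
dominating `∫ ‖ξ‖² Φ²`, for `t ∈ [0, T]`:
`∫⁻ (∑ⱼ‖v'(t)ⱼ‖ₑ)² ≤ 2 α₀ + 18 T I` (the low-frequency envelope bound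
`‖E'(t,η)‖ₑ² ≤ ‖η‖² T ∫⁻ φ_η²`). [cite: Tao2011, Thm. 5.4 (ii) WITH force (arXiv:1108.1165 Thm. 31 (ii), p. 18);
proof of Thm. 5.1 (arXiv Thm. 28, p. 16); Lemma 2.1 = arXiv Lemma 23] -/
theorem sup_majorant_next_sq_le' (hc : 0 < c)
    (ha : AEStronglyMeasurable a volume)
    (haw : ∀ (k : ℕ) j, ∫⁻ η, (ENNReal.ofReal ((1 + ‖η‖) ^ k) * ‖a η j‖ₑ) ^ 2 < ⊤)
    (hEm : Measurable (uncurry E)) (hEt : ∀ η, Continuous fun s => E s η)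
    (hEd : ∀ K : ℕ, ∃ B : ℝ, ∀ t, HasDecay K B (E t))
    {I : ℝ≥0∞}
    (hI : ∫⁻ ξ, ENNReal.ofReal (‖ξ‖ ^ 2) * ∫⁻ s in Ioc 0 T, (ENNReal.ofReal (4 * π) *
        (Fintype.card (Fin 3) : ℝ≥0∞) ^ 2 *
        ‖fconv (fun η => ((∑ j, ‖(heat c η (clamp T s) • a η - E s η) j‖ : ℝ) : ℂ))
          (fun η => ((∑ j, ‖(heat c η (clamp T s) • a η - E s η) j‖ : ℝ) : ℂ)) ξ‖ₑ) ^ 2 ≤ I)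
    {t : ℝ} (ht : t ∈ Icc 0 T) :
    ∫⁻ η, (∑ j, ‖(heat c η (clamp T t) • a η -
        duhamelIntegral c T (fun s ζ => heat c ζ (clamp T s) • a ζ - E s ζ) t η) j‖ₑ) ^ 2 ≤
      2 * (∫⁻ η, (∑ j, ‖a η j‖ₑ) ^ 2) + 18 * ENNReal.ofReal T * I := by
  set v : ℝ → EuclideanSpace ℝ (Fin 3) → Fin 3 → ℂ := fun s η => heat c η (clamp T s) • a η - E s η with hv
  set E' := duhamelIntegral c T v with hE'
  set m₀ := Module.finrank ℝ (EuclideanSpace ℝ (Fin 3)) + 1 with hm₀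
  have hm₀lt : Module.finrank ℝ (EuclideanSpace ℝ (Fin 3)) < 2 * m₀ := finrank_lt_two_mul_succ
  have ha2 : ∀ j, ∫⁻ η, ‖a η j‖ₑ ^ 2 < ⊤ := fun j => by simpa using haw 0 j
  obtain ⟨B₀, hB₀⟩ := hEd m₀
  have hvm : ∀ s, AEStronglyMeasurable (v s) volume := aestronglyMeasurable_hsub_slice' c T a E ha hEm
  have hv2 : ∀ s j, MemLp (v s · j) 2 volume := memLp_hsub_apply' c T a E hc.le ha ha2 hEm hm₀lt hB₀
  have hvc : ∀ j s₀, Tendsto (fun s => eLpNorm ((v s · j) - (v s₀ · j)) 2 volume) (𝓝 s₀) (𝓝 0) :=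
    tendsto_eLpNorm_hsub_apply' c T a E hc.le ha ha2 hEm hEt hm₀lt hB₀
  set Φsq : EuclideanSpace ℝ (Fin 3) → ℝ≥0∞ := fun ξ => ∫⁻ s in Ioc 0 T, (ENNReal.ofReal (4 * π) *
    (Fintype.card (Fin 3) : ℝ≥0∞) ^ 2 * ‖fconv (fun η => ((∑ j, ‖v s η j‖ : ℝ) : ℂ))
      (fun η => ((∑ j, ‖v s η j‖ : ℝ) : ℂ)) ξ‖ₑ) ^ 2 with hΦsq
  have henv : ∀ η, ‖E' t η‖ₑ ^ 2 ≤ ENNReal.ofReal (‖η‖ ^ 2 * T) * Φsq η := by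
    intro η
    have h := enorm_bilinDuhamel_sq_le_low (T := T) hc.le hvm hvm hv2 hv2 hvc hvc ht η
    rw [hE', duhamelIntegral, clamp_of_mem ht]
    exact h
  have hsplit := lintegral_weight_majorant_sub_sq_le (T := T) (a := a) (E := E') hc.le ha
    (W := fun _ => 1) measurable_const t
  simp only [one_mul] at hsplit
  have hE'maj : ∫⁻ η, (∑ j, ‖E' t η j‖ₑ) ^ 2 ≤ 9 * ENNReal.ofReal T * I := by
    calc ∫⁻ η, (∑ j, ‖E' t η j‖ₑ) ^ 2
        ≤ ∫⁻ η, 9 * ENNReal.ofReal T * (ENNReal.ofReal (‖η‖ ^ 2) * Φsq η) := by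
          refine lintegral_mono fun η => ?_
          calc (∑ j, ‖E' t η j‖ₑ) ^ 2 ≤ 9 * ‖E' t η‖ₑ ^ 2 := majorant_sq_le_nine_mul_enorm_sq _
            _ ≤ 9 * (ENNReal.ofReal (‖η‖ ^ 2 * T) * Φsq η) := by gcongr; exact henv η
            _ = 9 * ENNReal.ofReal T * (ENNReal.ofReal (‖η‖ ^ 2) * Φsq η) := by
                rw [ENNReal.ofReal_mul (by positivity)]; ring
      _ = 9 * ENNReal.ofReal T * ∫⁻ η, ENNReal.ofReal (‖η‖ ^ 2) * Φsq η :=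
          lintegral_const_mul' _ _ (ENNReal.mul_ne_top (by norm_num) ENNReal.ofReal_ne_top)
      _ ≤ 9 * ENNReal.ofReal T * I := mul_le_mul' le_rfl hI
  calc ∫⁻ η, (∑ j, ‖(heat c η (clamp T t) • a η - E' t η) j‖ₑ) ^ 2
      ≤ 2 * (∫⁻ η, (∑ j, ‖a η j‖ₑ) ^ 2) + 2 * (∫⁻ η, (∑ j, ‖E' t η j‖ₑ) ^ 2) := hsplit
    _ ≤ 2 * (∫⁻ η, (∑ j, ‖a η j‖ₑ) ^ 2) + 2 * (9 * ENNReal.ofReal T * I) := by gcongr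
    _ = _ := by ring

/-- **Plain `L²` transfer.** With the notation of `sup_weight_majorant_next_sq_le` and `I`
dominating `∫ ‖ξ‖² Φ²`, for `t ∈ [0, T]`:
`∫⁻ (∑ⱼ‖v'(t)ⱼ‖ₑ)² ≤ 2 α₀ + 18 T I` (the low-frequency envelope bound
`‖E'(t,η)‖ₑ² ≤ ‖η‖² T ∫⁻ φ_η²`). [folklore] -/
theorem sup_majorant_next_sq_le (hc : 0 < c)
    (ha : AEStronglyMeasurable a volume)
    (haw : ∀ (k : ℕ) j, ∫⁻ η, (ENNReal.ofReal ((1 + ‖η‖) ^ k) * ‖a η j‖ₑ) ^ 2 < ⊤)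
    (hEc : Continuous (uncurry E)) (hEd : ∀ K : ℕ, ∃ B : ℝ, ∀ t, HasDecay K B (E t))
    {I : ℝ≥0∞}
    (hI : ∫⁻ ξ, ENNReal.ofReal (‖ξ‖ ^ 2) * ∫⁻ s in Ioc 0 T, (ENNReal.ofReal (4 * π) *
        (Fintype.card (Fin 3) : ℝ≥0∞) ^ 2 *
        ‖fconv (fun η => ((∑ j, ‖(heat c η (clamp T s) • a η - E s η) j‖ : ℝ) : ℂ))
          (fun η => ((∑ j, ‖(heat c η (clamp T s) • a η - E s η) j‖ : ℝ) : ℂ)) ξ‖ₑ) ^ 2 ≤ I)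
    {t : ℝ} (ht : t ∈ Icc 0 T) :
    ∫⁻ η, (∑ j, ‖(heat c η (clamp T t) • a η -
        duhamelIntegral c T (fun s ζ => heat c ζ (clamp T s) • a ζ - E s ζ) t η) j‖ₑ) ^ 2 ≤
      2 * (∫⁻ η, (∑ j, ‖a η j‖ₑ) ^ 2) + 18 * ENNReal.ofReal T * I :=
  sup_majorant_next_sq_le' hc ha haw hEc.measurable (fun η => hEc.uncurry_right η) hEd hI ht

/-! ### `L²`-in-time transfer (heat `L²_t` gain + Schur bound of the step) -/

/-- The heat factor's `L²_t` gain at a fixed frequency, `ℝ≥0∞` form: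
`‖η‖^{2k+2} ∫⁻_{(0,T]} heat(c, η, s)² ds ≤ (2c)⁻¹ ‖η‖^{2k}` for `0 ≤ T`
(tree `two_mul_norm_sq_mul_integral_heat_sq_le`). [folklore] -/
theorem norm_pow_mul_lintegral_heat_sq_le (hc : 0 < c) (hT : 0 ≤ T) (k : ℕ)
    (η : EuclideanSpace ℝ (Fin 3)) :
    ENNReal.ofReal (‖η‖ ^ (2 * k + 2)) * ∫⁻ s in Ioc 0 T, ENNReal.ofReal (heat c η s ^ 2) ≤
      ENNReal.ofReal (1 / (2 * c)) * ENNReal.ofReal (‖η‖ ^ (2 * k)) := by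
  rw [lintegral_Ioc_ofReal_eq_ofReal_integral (by unfold heat; fun_prop) (fun s => sq_nonneg _) hT,
    ← ENNReal.ofReal_mul (by positivity), ← ENNReal.ofReal_mul (by positivity)]
  refine ENNReal.ofReal_le_ofReal ?_
  have h := two_mul_norm_sq_mul_integral_heat_sq_le c η 0 T
  have heq : ∫ s in (0 : ℝ)..T, heat c η s ^ 2 = ∫ r in (0 : ℝ)..T, heat c η (T - r) ^ 2 := by
    rw [intervalIntegral.integral_comp_sub_left (fun r => heat c η r ^ 2) T]
    simp
  rw [heq]
  have h2 : ‖η‖ ^ 2 * ∫ r in (0 : ℝ)..T, heat c η (T - r) ^ 2 ≤ 1 / (2 * c) := by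
    rw [le_div_iff₀ (by positivity)]; nlinarith [h]
  calc ‖η‖ ^ (2 * k + 2) * ∫ r in (0 : ℝ)..T, heat c η (T - r) ^ 2
      = ‖η‖ ^ (2 * k) * (‖η‖ ^ 2 * ∫ r in (0 : ℝ)..T, heat c η (T - r) ^ 2) := by ring
    _ ≤ ‖η‖ ^ (2 * k) * (1 / (2 * c)) := mul_le_mul_of_nonneg_left h2 (by positivity)
    _ = 1 / (2 * c) * ‖η‖ ^ (2 * k) := by ring

/-- **`L²`-in-time transfer, weight `‖η‖^{k+2}` (`k + 1 ≥ 1`).** With the notation of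
`sup_weight_majorant_next_sq_le` and `I` dominating `∫ ‖ξ‖^{2(k+1)} Φ²`,

  `∫⁻_{(0,T]} ∫⁻ (‖η‖^{k+2} ∑ⱼ‖v'(s)ⱼ‖ₑ)² dη ds ≤ c⁻¹ α_{k+1} + 18 c⁻² I`:

the heat part of `v'` gains one power of `‖η‖` from `2c‖η‖² ∫₀ᵀ heat² ≤ 1`, the Duhamel part
from the Schur bound `c‖η‖⁴ ∫⁻‖E'(s,η)‖ₑ² ds ≤ c⁻¹‖η‖² ∫⁻ φ_η²` (`lintegral_enorm_bilinDuhamel_sq_le`)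
— the `L²_t Ḣ^{s+1}` half of Tao's energy estimate (energy-duh2) on the Fourier side.
[cite: Tao2011, Lemma 2.1 (arXiv Lemma 23)]
Twin for the wide (jointly measurable, time-continuous at each frequency) class of `E`. -/
theorem lintegral_time_weight_majorant_next_sq_le' (hc : 0 < c) (hT : 0 ≤ T)
    (ha : AEStronglyMeasurable a volume)
    (haw : ∀ (k : ℕ) j, ∫⁻ η, (ENNReal.ofReal ((1 + ‖η‖) ^ k) * ‖a η j‖ₑ) ^ 2 < ⊤)
    (hEm : Measurable (uncurry E)) (hEt : ∀ η, Continuous fun s => E s η)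
    (hEd : ∀ K : ℕ, ∃ B : ℝ, ∀ t, HasDecay K B (E t))
    (k : ℕ) {I : ℝ≥0∞}
    (hI : ∫⁻ ξ, ENNReal.ofReal (‖ξ‖ ^ (2 * (k + 1))) * ∫⁻ s in Ioc 0 T, (ENNReal.ofReal (4 * π) *
        (Fintype.card (Fin 3) : ℝ≥0∞) ^ 2 *
        ‖fconv (fun η => ((∑ j, ‖(heat c η (clamp T s) • a η - E s η) j‖ : ℝ) : ℂ))
          (fun η => ((∑ j, ‖(heat c η (clamp T s) • a η - E s η) j‖ : ℝ) : ℂ)) ξ‖ₑ) ^ 2 ≤ I) :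
    ∫⁻ s in Ioc 0 T, ∫⁻ η, (ENNReal.ofReal (‖η‖ ^ (k + 2)) * ∑ j, ‖(heat c η (clamp T s) • a η -
        duhamelIntegral c T (fun s ζ => heat c ζ (clamp T s) • a ζ - E s ζ) s η) j‖ₑ) ^ 2 ≤
      ENNReal.ofReal (1 / c) * (∫⁻ η, (ENNReal.ofReal (‖η‖ ^ (k + 1)) * ∑ j, ‖a η j‖ₑ) ^ 2) +
        18 * ENNReal.ofReal (c⁻¹ ^ 2) * I := by
  set v : ℝ → EuclideanSpace ℝ (Fin 3) → Fin 3 → ℂ := fun s η => heat c η (clamp T s) • a η - E s η with hv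
  set E' := duhamelIntegral c T v with hE'
  set m₀ := Module.finrank ℝ (EuclideanSpace ℝ (Fin 3)) + 1 with hm₀
  have hm₀lt : Module.finrank ℝ (EuclideanSpace ℝ (Fin 3)) < 2 * m₀ := finrank_lt_two_mul_succ
  have ha2 : ∀ j, ∫⁻ η, ‖a η j‖ₑ ^ 2 < ⊤ := fun j => by simpa using haw 0 j
  obtain ⟨B₀, hB₀⟩ := hEd m₀
  have hvm : ∀ s, AEStronglyMeasurable (v s) volume := aestronglyMeasurable_hsub_slice' c T a E ha hEm
  have hv2 : ∀ s j, MemLp (v s · j) 2 volume := memLp_hsub_apply' c T a E hc.le ha ha2 hEm hm₀lt hB₀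
  have hvc : ∀ j s₀, Tendsto (fun s => eLpNorm ((v s · j) - (v s₀ · j)) 2 volume) (𝓝 s₀) (𝓝 0) :=
    tendsto_eLpNorm_hsub_apply' c T a E hc.le ha ha2 hEm hEt hm₀lt hB₀
  have hE'c : Continuous (uncurry E') := continuous_duhamelIntegral_of_tendsto hv2 hvc
  set Φsq : EuclideanSpace ℝ (Fin 3) → ℝ≥0∞ := fun ξ => ∫⁻ s in Ioc 0 T, (ENNReal.ofReal (4 * π) *
    (Fintype.card (Fin 3) : ℝ≥0∞) ^ 2 * ‖fconv (fun η => ((∑ j, ‖v s η j‖ : ℝ) : ℂ))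
      (fun η => ((∑ j, ‖v s η j‖ : ℝ) : ℂ)) ξ‖ₑ) ^ 2 with hΦsq
  -- the Schur bound of the step at every frequency
  have hschur : ∀ η, ENNReal.ofReal (c * ‖η‖ ^ 4) * ∫⁻ s in Ioc 0 T, ‖E' s η‖ₑ ^ 2 ≤
      ENNReal.ofReal (c⁻¹ * ‖η‖ ^ 2) * Φsq η := by
    intro η
    have h := lintegral_enorm_bilinDuhamel_sq_le (T := T) hc hvm hvm hv2 hv2 hvc hvc η
    refine le_trans (le_of_eq ?_) h
    congr 1
    refine setLIntegral_congr_fun measurableSet_Ioc fun s hs => ?_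
    rw [hE', duhamelIntegral, clamp_of_mem ⟨hs.1.le, hs.2⟩]
  -- the integrand and its pointwise split
  set F : ℝ → EuclideanSpace ℝ (Fin 3) → ℝ≥0∞ := fun s η =>
    (ENNReal.ofReal (‖η‖ ^ (k + 2)) * ∑ j, ‖(heat c η (clamp T s) • a η - E' s η) j‖ₑ) ^ 2 with hF
  set A : EuclideanSpace ℝ (Fin 3) → ℝ≥0∞ := fun η => ∑ j, ‖a η j‖ₑ with hA
  set ME : ℝ → EuclideanSpace ℝ (Fin 3) → ℝ≥0∞ := fun s η => ∑ j, ‖E' s η j‖ₑ with hME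
  have hsq : ∀ x y : ℝ≥0∞, (x + y) ^ 2 ≤ 2 * x ^ 2 + 2 * y ^ 2 := fun x y => by
    have h := ENNReal.rpow_add_le_mul_rpow_add_rpow x y (p := 2) (by norm_num)
    norm_num at h
    rw [← mul_add]
    exact_mod_cast h
  have hpt : ∀ s η, F s η ≤ 2 * (ENNReal.ofReal (‖η‖ ^ (k + 2)) * (ENNReal.ofReal (heat c η (clamp T s)) * A η)) ^ 2 +
      2 * (ENNReal.ofReal (‖η‖ ^ (k + 2)) * ME s η) ^ 2 := by
    intro s η
    have hmaj : (∑ j, ‖(heat c η (clamp T s) • a η - E' s η) j‖ₑ) ≤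
        ENNReal.ofReal (heat c η (clamp T s)) * A η + ME s η := by
      rw [hA, hME, Finset.mul_sum, ← Finset.sum_add_distrib]
      refine Finset.sum_le_sum fun j _ => ?_
      rw [Pi.sub_apply, heat_smul_apply]
      refine (enorm_sub_le).trans (le_of_eq ?_)
      rw [enorm_mul, ← ofReal_norm, Complex.norm_real, Real.norm_of_nonneg (heat_nonneg c η _)]
    calc F s η ≤ (ENNReal.ofReal (‖η‖ ^ (k + 2)) * (ENNReal.ofReal (heat c η (clamp T s)) * A η + ME s η)) ^ 2 := by
          simp only [hF]; gcongr
      _ = _ := by rw [mul_add]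
      _ ≤ _ := hsq _ _
  -- Tonelli
  have hFm : AEMeasurable (uncurry F) ((volume.restrict (Ioc 0 T)).prod volume) := by
    have hj := aestronglyMeasurable_uncurry_hsub c T a E' ha hE'c
    have h1 : AEMeasurable (uncurry F) (volume.prod volume) := by
      refine (((ENNReal.continuous_ofReal.comp (continuous_norm.pow (k + 2))).measurable.comp_aemeasurable
        measurable_snd.aemeasurable).mul ?_).pow_const 2
      exact Finset.aemeasurable_fun_sum _ fun j _ =>
        ((continuous_apply j).comp_aestronglyMeasurable hj).enorm
    exact h1.mono_ac (Measure.AbsolutelyContinuous.prod Measure.restrict_le_self.absolutelyContinuous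
      Measure.AbsolutelyContinuous.rfl)
  rw [lintegral_lintegral_swap hFm]
  -- per-frequency time integrals
  have hheat : ∀ η, ∫⁻ s in Ioc 0 T, 2 * (ENNReal.ofReal (‖η‖ ^ (k + 2)) *
      (ENNReal.ofReal (heat c η (clamp T s)) * A η)) ^ 2 ≤
      2 * (ENNReal.ofReal (1 / (2 * c)) * (ENNReal.ofReal (‖η‖ ^ (k + 1)) * A η) ^ 2) := by
    intro η
    have hAtop : A η ^ 2 ≠ ⊤ ∨ True := Or.inr trivial
    calc ∫⁻ s in Ioc 0 T, 2 * (ENNReal.ofReal (‖η‖ ^ (k + 2)) * (ENNReal.ofReal (heat c η (clamp T s)) * A η)) ^ 2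
        = ∫⁻ s in Ioc 0 T, (2 * (ENNReal.ofReal (‖η‖ ^ (2 * k + 2 + 2)) * A η ^ 2)) *
            ENNReal.ofReal (heat c η s ^ 2) := by
          refine setLIntegral_congr_fun measurableSet_Ioc fun s hs => ?_
          rw [clamp_of_mem ⟨hs.1.le, hs.2⟩, mul_pow, mul_pow, ← ENNReal.ofReal_pow (by positivity),
            ← ENNReal.ofReal_pow (heat_nonneg c η s), ← pow_mul]
          ring_nf
      _ = (2 * (ENNReal.ofReal (‖η‖ ^ (2 * k + 2 + 2)) * A η ^ 2)) *
            ∫⁻ s in Ioc 0 T, ENNReal.ofReal (heat c η s ^ 2) := by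
          rw [lintegral_const_mul'' (f := fun s => ENNReal.ofReal (heat c η s ^ 2)) _
            ((ENNReal.continuous_ofReal.comp (by unfold heat; fun_prop)).measurable.aemeasurable)]
      _ = 2 * A η ^ 2 * (ENNReal.ofReal (‖η‖ ^ (2 * (k + 1) + 2)) *
            ∫⁻ s in Ioc 0 T, ENNReal.ofReal (heat c η s ^ 2)) := by ring_nf
      _ ≤ 2 * A η ^ 2 * (ENNReal.ofReal (1 / (2 * c)) * ENNReal.ofReal (‖η‖ ^ (2 * (k + 1)))) :=
          mul_le_mul' le_rfl (norm_pow_mul_lintegral_heat_sq_le hc hT (k + 1) η)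
      _ = 2 * (ENNReal.ofReal (1 / (2 * c)) * (ENNReal.ofReal (‖η‖ ^ (k + 1)) * A η) ^ 2) := by
          rw [mul_pow, ← ENNReal.ofReal_pow (by positivity), ← pow_mul, mul_comm (k + 1) 2]; ring
  have hduh : ∀ η, ∫⁻ s in Ioc 0 T, 2 * (ENNReal.ofReal (‖η‖ ^ (k + 2)) * ME s η) ^ 2 ≤
      18 * ENNReal.ofReal (c⁻¹ ^ 2) * (ENNReal.ofReal (‖η‖ ^ (2 * (k + 1))) * Φsq η) := by
    intro η
    have hMEm : AEMeasurable (fun s => ME s η) (volume.restrict (Ioc 0 T)) :=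
      (Finset.aemeasurable_fun_sum _ fun j _ => (((continuous_apply j).comp
        (hE'c.comp₂ continuous_id continuous_const)).measurable.enorm.aemeasurable))
    calc ∫⁻ s in Ioc 0 T, 2 * (ENNReal.ofReal (‖η‖ ^ (k + 2)) * ME s η) ^ 2
        ≤ ∫⁻ s in Ioc 0 T, (18 * ENNReal.ofReal (‖η‖ ^ (2 * k + 4))) * ‖E' s η‖ₑ ^ 2 := by
          refine lintegral_mono fun s => ?_
          rw [mul_pow, ← ENNReal.ofReal_pow (by positivity), ← pow_mul]
          calc 2 * (ENNReal.ofReal (‖η‖ ^ ((k + 2) * 2)) * ME s η ^ 2)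
              ≤ 2 * (ENNReal.ofReal (‖η‖ ^ ((k + 2) * 2)) * (9 * ‖E' s η‖ₑ ^ 2)) := by
                gcongr; exact majorant_sq_le_nine_mul_enorm_sq _
            _ = _ := by ring_nf
      _ = (18 * ENNReal.ofReal (‖η‖ ^ (2 * k + 4))) * ∫⁻ s in Ioc 0 T, ‖E' s η‖ₑ ^ 2 :=
          lintegral_const_mul' _ _ (ENNReal.mul_ne_top (by norm_num) ENNReal.ofReal_ne_top)
      _ = 18 * (ENNReal.ofReal (c⁻¹ * ‖η‖ ^ (2 * k)) * ENNReal.ofReal (c * ‖η‖ ^ 4)) *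
            ∫⁻ s in Ioc 0 T, ‖E' s η‖ₑ ^ 2 := by
          congr 2
          rw [← ENNReal.ofReal_mul (by positivity)]
          congr 1
          field_simp
          ring
      _ = 18 * ENNReal.ofReal (c⁻¹ * ‖η‖ ^ (2 * k)) * (ENNReal.ofReal (c * ‖η‖ ^ 4) *
            ∫⁻ s in Ioc 0 T, ‖E' s η‖ₑ ^ 2) := by ring
      _ ≤ 18 * ENNReal.ofReal (c⁻¹ * ‖η‖ ^ (2 * k)) * (ENNReal.ofReal (c⁻¹ * ‖η‖ ^ 2) * Φsq η) :=
          mul_le_mul' le_rfl (hschur η)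
      _ = 18 * ENNReal.ofReal (c⁻¹ ^ 2) * (ENNReal.ofReal (‖η‖ ^ (2 * (k + 1))) * Φsq η) := by
          rw [mul_assoc 18, ← mul_assoc (ENNReal.ofReal _), ← ENNReal.ofReal_mul (by positivity),
            mul_assoc 18, ← mul_assoc (ENNReal.ofReal (c⁻¹ ^ 2)), ← ENNReal.ofReal_mul (by positivity)]
          congr 3
          ring
  -- assemble
  have hAm : AEMeasurable (fun η => 2 * (ENNReal.ofReal (1 / (2 * c)) *
      (ENNReal.ofReal (‖η‖ ^ (k + 1)) * A η) ^ 2)) volume :=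
    ((((ENNReal.continuous_ofReal.comp (continuous_norm.pow (k + 1))).measurable.aemeasurable.mul
      (aemeasurable_majorant ha)).pow_const 2).const_mul _).const_mul _
  calc ∫⁻ η, ∫⁻ s in Ioc 0 T, F s η
      ≤ ∫⁻ η, ((∫⁻ s in Ioc 0 T, 2 * (ENNReal.ofReal (‖η‖ ^ (k + 2)) *
          (ENNReal.ofReal (heat c η (clamp T s)) * A η)) ^ 2) +
          ∫⁻ s in Ioc 0 T, 2 * (ENNReal.ofReal (‖η‖ ^ (k + 2)) * ME s η) ^ 2) := by
        refine lintegral_mono fun η => (lintegral_mono fun s => hpt s η).trans ?_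
        exact le_of_eq (lintegral_add_left' ((((ENNReal.continuous_ofReal.comp (continuous_heat_comp c
          continuous_const (continuous_clamp T))).measurable.aemeasurable.mul aemeasurable_const).const_mul _
            |>.pow_const 2).const_mul _) _)
    _ ≤ ∫⁻ η, (2 * (ENNReal.ofReal (1 / (2 * c)) * (ENNReal.ofReal (‖η‖ ^ (k + 1)) * A η) ^ 2) +
          18 * ENNReal.ofReal (c⁻¹ ^ 2) * (ENNReal.ofReal (‖η‖ ^ (2 * (k + 1))) * Φsq η)) :=
        lintegral_mono fun η => add_le_add (hheat η) (hduh η)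
    _ = 2 * ENNReal.ofReal (1 / (2 * c)) * (∫⁻ η, (ENNReal.ofReal (‖η‖ ^ (k + 1)) * A η) ^ 2) +
          18 * ENNReal.ofReal (c⁻¹ ^ 2) * ∫⁻ η, ENNReal.ofReal (‖η‖ ^ (2 * (k + 1))) * Φsq η := by
        rw [lintegral_add_left' hAm, lintegral_const_mul' _ _ (by simp),
          lintegral_const_mul' _ _ ENNReal.ofReal_ne_top,
          lintegral_const_mul' _ _ (ENNReal.mul_ne_top (by norm_num) ENNReal.ofReal_ne_top), ← mul_assoc]
    _ ≤ 2 * ENNReal.ofReal (1 / (2 * c)) * (∫⁻ η, (ENNReal.ofReal (‖η‖ ^ (k + 1)) * A η) ^ 2) +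
          18 * ENNReal.ofReal (c⁻¹ ^ 2) * I := by gcongr
    _ = _ := by
        have h2c : (2 : ℝ≥0∞) * ENNReal.ofReal (1 / (2 * c)) = ENNReal.ofReal (1 / c) := by
          rw [← ENNReal.ofReal_ofNat, ← ENNReal.ofReal_mul (by norm_num)]
          congr 1
          field_simp
        rw [h2c]

/-- **`L²`-in-time transfer, weight `‖η‖^{k+2}` (`k + 1 ≥ 1`).** With the notation of
`sup_weight_majorant_next_sq_le` and `I` dominating `∫ ‖ξ‖^{2(k+1)} Φ²`,

  `∫⁻_{(0,T]} ∫⁻ (‖η‖^{k+2} ∑ⱼ‖v'(s)ⱼ‖ₑ)² dη ds ≤ c⁻¹ α_{k+1} + 18 c⁻² I`: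

the heat part of `v'` gains one power of `‖η‖` from `2c‖η‖² ∫₀ᵀ heat² ≤ 1`, the Duhamel part
from the Schur bound `c‖η‖⁴ ∫⁻‖E'(s,η)‖ₑ² ds ≤ c⁻¹‖η‖² ∫⁻ φ_η²` (`lintegral_enorm_bilinDuhamel_sq_le`)
— the `L²_t Ḣ^{s+1}` half of Tao's energy estimate (energy-duh2) on the Fourier side.
[cite: Tao2011, Lemma 2.1 (arXiv Lemma 23)] -/
theorem lintegral_time_weight_majorant_next_sq_le (hc : 0 < c) (hT : 0 ≤ T)
    (ha : AEStronglyMeasurable a volume)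
    (haw : ∀ (k : ℕ) j, ∫⁻ η, (ENNReal.ofReal ((1 + ‖η‖) ^ k) * ‖a η j‖ₑ) ^ 2 < ⊤)
    (hEc : Continuous (uncurry E)) (hEd : ∀ K : ℕ, ∃ B : ℝ, ∀ t, HasDecay K B (E t))
    (k : ℕ) {I : ℝ≥0∞}
    (hI : ∫⁻ ξ, ENNReal.ofReal (‖ξ‖ ^ (2 * (k + 1))) * ∫⁻ s in Ioc 0 T, (ENNReal.ofReal (4 * π) *
        (Fintype.card (Fin 3) : ℝ≥0∞) ^ 2 *
        ‖fconv (fun η => ((∑ j, ‖(heat c η (clamp T s) • a η - E s η) j‖ : ℝ) : ℂ))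
          (fun η => ((∑ j, ‖(heat c η (clamp T s) • a η - E s η) j‖ : ℝ) : ℂ)) ξ‖ₑ) ^ 2 ≤ I) :
    ∫⁻ s in Ioc 0 T, ∫⁻ η, (ENNReal.ofReal (‖η‖ ^ (k + 2)) * ∑ j, ‖(heat c η (clamp T s) • a η -
        duhamelIntegral c T (fun s ζ => heat c ζ (clamp T s) • a ζ - E s ζ) s η) j‖ₑ) ^ 2 ≤
      ENNReal.ofReal (1 / c) * (∫⁻ η, (ENNReal.ofReal (‖η‖ ^ (k + 1)) * ∑ j, ‖a η j‖ₑ) ^ 2) +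
        18 * ENNReal.ofReal (c⁻¹ ^ 2) * I :=
  lintegral_time_weight_majorant_next_sq_le' hc hT ha haw hEc.measurable (fun η => hEc.uncurry_right η) hEd k hI

end Literature.Analysis.FluidPDE.FourierNS

end
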